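import Mathlib
import HarnessLib
import Summits.NavierStokesRegularity.NavierStokesRegularity.Theorems.UnthreadedDoorCellFluxNetFluxLeClusterFlux
import Summits.NavierStokesRegularity.NavierStokesRegularity.Theorems.UnthreadedDoorNetFluxOneSidedLawPointwise
import Summits.NavierStokesRegularity.NavierStokesRegularity.Theorems.UnthreadedDoorIndicatrixNetFluxDecayTail

/-!
# Route `UnthreadedDoor`, crux `PoloidalLiouville` (stmt-NavierStokesRegularity-1222), WALL W1 — crux idea «indicatrix-bound», Λ-4:
# decay ⇒ K3^ω (`AnalyticDataTypeIScalarLiouville`), the count-free re-run of the cell-flux Σ-4 CORE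

★ `analyticData_of_decay : <Λ-1 `HeadClusterRuleTame`> → <Λ-3 `ClusterFluxWindowDecayTame` (v1.7.5: binder 8 = the HESSIAN bound)> → ClusterFluxZero →
<Λ-geo `AnalyticCellFiniteness`> → <NF-2 `TypeIVorticityBound`> → <Λ-T′ `TypeIHessianBound`> → <K3^ω `AnalyticDataTypeIScalarLiouville`>` — the registered stub
`stub_analyticData_of_decay` of `Cruxes/PoloidalLiouville/IndicatrixSketch.lean` v1.7.5 (custodian ns-idea-14 g13, who adopted ns-qj-p1 g8's typing note:
Λ-3's binder 8 is now `‖iteratedFDeriv ℝ 2 (v t) x‖ ≤ C₂ / √(−t)^3`), all sketch-local Props unfolded VERBATIM (`ClusterFluxZero` is the CellFlux Defs twin's,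
p692073), so the sketch closes it by the bare term.

Proof = ns-qj-p1 g7's Σ-4 CORE `CellFlux.cellTameAnalytic_of_decayIntegrable` (p723451) made count-free: at a time `t < 0` and for every `t₁ ≤ t`, on the
window `]t₁ − 1, 0[` the head potential `P` is built from `(v, T)` (`NetFlux.exists_headPotential`, p673116), the slices are cell-finite by Λ-geo applied to
the analytic slices of `T`, Λ-1 supplies an admissible rule with preconnected class ranges, NF-2 / Λ-T (`Indicatrix.typeIVorticityGradientBound`, p-landed by
ns-wall-eng-4 — not needed in v1.7.5: `C₂` now comes straight from the `TypeIHessianBound` antecedent) supply the Type-I constants `C₁`, `C₂`, Λ-3 gives `∫₀ᴿ clusterFlux ≤ A (C₁ + C₂) (1 + R/√(−t))³ (t/t₁)^λ` with integrability,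
`netFlux ≤ clusterFlux` (p722300) passes it to the rule-independent cumulative net flux, and the PER-DATA tail
`Indicatrix.cross_gradient_eq_zero_of_netFluxWindowBound` (`t₁ → −∞`; the uniform interface `NetFluxWindowDecayOn` cannot carry the data-dependent constant
`C₂`) gives `∇T(t) × (x − x₀) = 0`.  The hypothesis `ClusterFluxZero` is carried, unused, for the by-name match (unused on this road, as in Σ-4).  HONEST: bookkeeping under crux 1222; Λ-1, Λ-2 (behind Λ-3), Λ-3 are
OPEN; W1 movement 0; NS regularity NOT proved.  `--supports stmt-NavierStokesRegularity-1222 --as helper`.  [folklore]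
-/

noncomputable section

-- the summit and its single sub-problem share the name (CONVENTIONS §1)
set_option linter.dupNamespace false

open Set Function Filter Topology InnerProductSpace Metric MeasureTheory
open scoped RealInnerProductSpace

namespace Summit.NavierStokesRegularity.NavierStokesRegularity.Theorems.PoloidalLiouville.Indicatrix

open Literature.Analysis Literature.Analysis.FluidPDE
open Summit.NavierStokesRegularity.NavierStokesRegularity.Theorems.PoloidalLiouville.NetFlux
  (E3 sphSup sphInf sphOsc netFlux CurledLaw exists_headPotential cross_sub_smul_eq_zero_of_head)
open Summit.NavierStokesRegularity.NavierStokesRegularity.Theorems.PoloidalLiouville.CellFlux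
  (sphCrit isoCrit cellSet clusterFlux IsClusterPartition AdmissibleRule cellFinitePred ClusterFluxZero netFlux_le_clusterFlux)

set_option maxHeartbeats 800000 in
/-- ★ **Λ-4: window decay on the count-free stratum ⇒ Type-I scalar Liouville for jointly analytic unthreaded data** (the bodies of Λ-1
`HeadClusterRuleTame`, Λ-3 `ClusterFluxWindowDecayTame` (v1.7.5, Hessian binder), Σ-0c `ClusterFluxZero`, Λ-geo `AnalyticCellFiniteness`, NF-2 `TypeIVorticityBound`, Λ-T′ `TypeIHessianBound`
and K3^ω `AnalyticDataTypeIScalarLiouville`, verbatim). [folklore] -/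
theorem analyticData_of_decay
    (h1 : ∀ (v : ℝ → E3 → E3) (x₀ : E3) (T P : ℝ → E3 → ℝ) (V : ℝ → ℝ) (t₀ : ℝ),
      ContDiffOn ℝ (⊤ : ℕ∞) (uncurry v) (Ioo t₀ 0 ×ˢ univ) →
      ContDiffOn ℝ (⊤ : ℕ∞) (uncurry T) (Ioo t₀ 0 ×ˢ ({x₀}ᶜ : Set E3)) →
      (∀ t ∈ Ioo t₀ 0, ContDiffOn ℝ 1 (P t) ({x₀}ᶜ : Set E3)) →
      (∀ t ∈ Ioo t₀ 0, ∀ x, ‖v t x‖ ≤ V t) →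
      (∀ t ∈ Ioo t₀ 0, ∀ x, x ≠ x₀ →
          cross (gradient (P t) x - (inner ℝ (v t x) (x - x₀)) • gradient (T t) x) (x - x₀) = 0) →
      (∀ t ∈ Ioo t₀ 0, ∀ x, curl (v t) x = cross (gradient (T t) x) (x - x₀)) →
      CurledLaw v x₀ T (Ioo t₀ 0) →
      AnalyticOnNhd ℝ (uncurry v) (Ioo t₀ 0 ×ˢ (univ : Set E3)) →
      AnalyticOnNhd ℝ (uncurry T) (Ioo t₀ 0 ×ˢ ({x₀}ᶜ : Set E3)) →
      (∀ t ∈ Ioo t₀ 0, cellFinitePred v x₀ T t) →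
      ∃ 𝒞 : ℝ → ℝ → Set (Set E3), AdmissibleRule x₀ T P V t₀ 𝒞 ∧
        ∀ t ∈ Ioo t₀ 0, ∀ r > 0, ∀ K ∈ 𝒞 t r, IsPreconnected (T t '' K))
    (h3 : ∀ C : ℝ, 0 ≤ C → ∃ lam > (0 : ℝ), ∃ A : ℝ,
      ∀ (v : ℝ → E3 → E3) (x₀ : E3) (T P : ℝ → E3 → ℝ) (C₁ C₂ t₀ : ℝ), t₀ < 0 →
      ContDiffOn ℝ (⊤ : ℕ∞) (uncurry v) (Ioo t₀ 0 ×ˢ univ) →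
      AnalyticOnNhd ℝ (uncurry v) (Ioo t₀ 0 ×ˢ (univ : Set E3)) →
      ContDiffOn ℝ (⊤ : ℕ∞) (uncurry T) (Ioo t₀ 0 ×ˢ ({x₀}ᶜ : Set E3)) →
      (∀ t ∈ Ioo t₀ 0, ContDiffOn ℝ 1 (P t) ({x₀}ᶜ : Set E3)) →
      (∀ t ∈ Ioo t₀ 0, ∀ x, ‖v t x‖ ≤ C / Real.sqrt (-t)) →
      (∀ t ∈ Ioo t₀ 0, ∀ x, ‖curl (v t) x‖ ≤ C₁ / (-t)) →
      (∀ t ∈ Ioo t₀ 0, ∀ x, ‖iteratedFDeriv ℝ 2 (v t) x‖ ≤ C₂ / Real.sqrt (-t) ^ 3) →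
      (∀ t ∈ Ioo t₀ 0, ∀ x, x ≠ x₀ →
          cross (gradient (P t) x - (inner ℝ (v t x) (x - x₀)) • gradient (T t) x) (x - x₀) = 0) →
      (∀ t ∈ Ioo t₀ 0, ∀ x, curl (v t) x = cross (gradient (T t) x) (x - x₀)) →
      CurledLaw v x₀ T (Ioo t₀ 0) →
      (∀ t ∈ Ioo t₀ 0, cellFinitePred v x₀ T t) →
      ∀ 𝒞 : ℝ → ℝ → Set (Set E3), AdmissibleRule x₀ T P (fun t => C / Real.sqrt (-t)) t₀ 𝒞 →
      (∀ t ∈ Ioo t₀ 0, ∀ r > 0, ∀ K ∈ 𝒞 t r, IsPreconnected (T t '' K)) →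
      ∀ t₁ t R : ℝ, t₀ < t₁ → t₁ ≤ t → t < 0 → 0 < R →
        IntegrableOn (fun r => clusterFlux (T t) r (𝒞 t r)) (Ioo 0 R) ∧
        ∫ r in Ioo 0 R, clusterFlux (T t) r (𝒞 t r)
          ≤ A * (C₁ + C₂) * (1 + R / Real.sqrt (-t)) ^ 3 * (t / t₁) ^ lam)
    (_h0 : ClusterFluxZero)
    (hgeo : ∀ (x₀ : E3) (f : E3 → ℝ) (r : ℝ), 0 < r → AnalyticOnNhd ℝ f ({x₀}ᶜ : Set E3) →
      (cellSet f x₀ r).Finite ∧ (isoCrit f x₀ r).Finite)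
    (hV : ∀ (v : ℝ → E3 → E3) (C : ℝ), IsBoundedAncientMildSolution 1 v → HasTypeITimeDecay C v →
      ContDiffOn ℝ (⊤ : ℕ∞) (uncurry v) (Iio 0 ×ˢ univ) →
      ∃ C₁ : ℝ, ∀ t < 0, ∀ x, ‖curl (v t) x‖ ≤ C₁ / (-t))
    (hH : ∀ (v : ℝ → E3 → E3) (C : ℝ), IsBoundedAncientMildSolution 1 v → HasTypeITimeDecay C v →
      ContDiffOn ℝ (⊤ : ℕ∞) (uncurry v) (Iio 0 ×ˢ univ) →
      ∃ C₂ : ℝ, ∀ t < 0, ∀ x, ‖iteratedFDeriv ℝ 2 (v t) x‖ ≤ C₂ / Real.sqrt (-t) ^ 3) :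
    ∀ (v : ℝ → E3 → E3) (x₀ : E3) (T : ℝ → E3 → ℝ),
      (∃ C : ℝ, HasTypeITimeDecay C v) →
      IsBoundedAncientMildSolution 1 v →
      (∀ t < 0, AEStronglyMeasurable (v t) volume) →
      ContDiffOn ℝ (⊤ : ℕ∞) (uncurry v) (Iio 0 ×ˢ univ) →
      ContDiffOn ℝ (⊤ : ℕ∞) (uncurry T) (Iio 0 ×ˢ ({x₀}ᶜ : Set E3)) →
      (∃ C : ℝ, ∀ t < 0, ∀ x, |T t x| ≤ C) →
      (∀ t < 0, ∀ x, curl (v t) x = cross (gradient (T t) x) (x - x₀)) →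
      CurledLaw v x₀ T (Iio 0) →
      AnalyticOnNhd ℝ (uncurry v) (Iio 0 ×ˢ (univ : Set E3)) →
      AnalyticOnNhd ℝ (uncurry T) (Iio 0 ×ˢ ({x₀}ᶜ : Set E3)) →
      ∀ t < 0, ∀ x, cross (gradient (T t) x) (x - x₀) = 0 := by
  intro v x₀ T hC hB _hmeas hsv hsT hTb hrep hE hvan hTan t ht
  obtain ⟨C, hCv⟩ := hC
  -- `0 ≤ C`
  have hC0 : 0 ≤ C := by
    have h := hCv (-1) (by norm_num) 0
    rw [neg_neg, Real.sqrt_one, div_one] at h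
    exact (norm_nonneg _).trans h
  obtain ⟨lam, hlam, A, hA⟩ := h3 C hC0
  -- the Type-I constants of the data
  obtain ⟨C₁, hC₁⟩ := hV v C hB hCv hsv
  obtain ⟨C₂, hC₂⟩ := hH v C hB hCv hsv
  -- ### the window bound at time `t`, for every `t₁ ≤ t` and `R > 0`
  refine cross_gradient_eq_zero_of_netFluxWindowBound hsT hTb ht hlam
    (fun R => A * (C₁ + C₂) * (1 + R / Real.sqrt (-t)) ^ 3) fun t₁ ht₁ R hR => ?_
  set t₀ : ℝ := t₁ - 1 with ht₀def
  have ht₀ : t₀ < 0 := by rw [ht₀def]; linarith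
  have ht₀₁ : t₀ < t₁ := by rw [ht₀def]; linarith
  have hsub : Ioo t₀ 0 ⊆ Iio (0 : ℝ) := Ioo_subset_Iio_self
  have htw : t ∈ Ioo t₀ 0 := ⟨by linarith, ht⟩
  -- the data on the window
  have hv : ContDiffOn ℝ (⊤ : ℕ∞) (uncurry v) (Ioo t₀ 0 ×ˢ univ) := hsv.mono (prod_mono hsub le_rfl)
  have hT : ContDiffOn ℝ (⊤ : ℕ∞) (uncurry T) (Ioo t₀ 0 ×ˢ ({x₀}ᶜ : Set E3)) := hsT.mono (prod_mono hsub le_rfl)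
  have hvanw : AnalyticOnNhd ℝ (uncurry v) (Ioo t₀ 0 ×ˢ (univ : Set E3)) := hvan.mono (prod_mono hsub le_rfl)
  have hTanw : AnalyticOnNhd ℝ (uncurry T) (Ioo t₀ 0 ×ˢ ({x₀}ᶜ : Set E3)) := hTan.mono (prod_mono hsub le_rfl)
  have hvC : ∀ s ∈ Ioo t₀ 0, ∀ x, ‖v s x‖ ≤ C / Real.sqrt (-s) := fun s hs => hCv s hs.2
  have hω : ∀ s ∈ Ioo t₀ 0, ∀ x, ‖curl (v s) x‖ ≤ C₁ / (-s) := fun s hs => hC₁ s hs.2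
  have hDω : ∀ s ∈ Ioo t₀ 0, ∀ x, ‖iteratedFDeriv ℝ 2 (v s) x‖ ≤ C₂ / Real.sqrt (-s) ^ 3 := fun s hs => hC₂ s hs.2
  have hlink : ∀ s ∈ Ioo t₀ 0, ∀ x, curl (v s) x = cross (gradient (T s) x) (x - x₀) := fun s hs => hrep s hs.2
  have hEw : CurledLaw v x₀ T (Ioo t₀ 0) := fun s hs => hE s (hsub hs)
  -- the slices are analytic and cell-finite (Λ-geo)
  have hvs : ∀ s ∈ Ioo t₀ 0, AnalyticOnNhd ℝ (v s) (univ : Set E3) := fun s hs y _ =>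
    (hvanw (s, y) ⟨hs, mem_univ _⟩).comp₂ analyticAt_const analyticAt_id
  have hTs : ∀ s ∈ Ioo t₀ 0, AnalyticOnNhd ℝ (T s) ({x₀}ᶜ : Set E3) := fun s hs y hy =>
    (hTanw (s, y) ⟨hs, hy⟩).comp₂ analyticAt_const analyticAt_id
  have hcell : ∀ s ∈ Ioo t₀ 0, cellFinitePred v x₀ T s := fun s hs =>
    ⟨hvs s hs, hTs s hs, fun r hr => hgeo x₀ (T s) r hr (hTs s hs)⟩
  -- head potential on the window and the tangential head relation
  obtain ⟨P, hP, hhead⟩ := exists_headPotential (v := v) (T := T) (x₀ := x₀) (t₀ := t₀) hv hT hEw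
  have hheadx : ∀ s ∈ Ioo t₀ 0, ∀ x, x ≠ x₀ →
      cross (gradient (P s) x - (inner ℝ (v s x) (x - x₀)) • gradient (T s) x) (x - x₀) = 0 :=
    fun s hs x hx => cross_sub_smul_eq_zero_of_head (hhead s hs x hx)
  -- the rule of Λ-1 on this window (classes with preconnected ranges)
  obtain ⟨𝒞, h𝒞, hpre⟩ := h1 v x₀ T P (fun s => C / Real.sqrt (-s)) t₀ hv hT hP hvC hheadx hlink hEw hvanw hTanw hcell
  -- decay with integrability (Λ-3)
  obtain ⟨hint, hdec⟩ := hA v x₀ T P C₁ C₂ t₀ ht₀ hv hvanw hT hP hvC hω hDω hheadx hlink hEw hcell 𝒞 h𝒞 hpre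
    t₁ t R ht₀₁ ht₁ ht hR
  -- `T t` is `C¹` off the centre
  have hTt : ContDiffOn ℝ 1 (T t) ({x₀}ᶜ : Set E3) := by
    have h1' : ContDiffOn ℝ (⊤ : ℕ∞) (T t) ({x₀}ᶜ : Set E3) :=
      hT.comp (contDiffOn_const.prodMk contDiffOn_id) fun y hy => mk_mem_prod htw hy
    exact h1'.of_le (WithTop.coe_le_coe.2 le_top)
  -- pointwise comparison `netFlux ≤ clusterFlux` and nonnegativity
  have hsph : ∀ {r : ℝ}, 0 < r → Metric.sphere x₀ r ⊆ ({x₀}ᶜ : Set E3) := fun hr z hz => ne_of_mem_sphere hz hr.ne'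
  have hnn : ∀ r, 0 < r → 0 ≤ netFlux (T t) x₀ r := by
    intro r hr
    have hfc : ContinuousOn (T t) (Metric.sphere x₀ r) := hTt.continuousOn.mono (hsph hr)
    have hcpt : IsCompact (T t '' Metric.sphere x₀ r) := (isCompact_sphere x₀ r).image_of_continuousOn hfc
    obtain ⟨y, hy⟩ := (NormedSpace.sphere_nonempty (x := x₀)).2 hr.le
    have h1' : T t y ≤ sSup (T t '' Metric.sphere x₀ r) := le_csSup hcpt.bddAbove ⟨y, hy, rfl⟩
    have h2' : sInf (T t '' Metric.sphere x₀ r) ≤ T t y := csInf_le hcpt.bddBelow ⟨y, hy, rfl⟩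
    unfold netFlux sphOsc sphSup sphInf
    exact mul_nonneg hr.le (by linarith)
  have hle : ∀ r ∈ Ioo 0 R, netFlux (T t) x₀ r ≤ clusterFlux (T t) r (𝒞 t r) := fun r hr =>
    netFlux_le_clusterFlux hr.1 hTt (h𝒞.1 t htw r hr.1)
  have hcmp : ∫ r in Ioo 0 R, netFlux (T t) x₀ r ≤ ∫ r in Ioo 0 R, clusterFlux (T t) r (𝒞 t r) := by
    refine integral_mono_of_nonneg ?_ hint ?_
    · exact (ae_restrict_iff' measurableSet_Ioo).2 (Eventually.of_forall fun r hr => hnn r hr.1)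
    · exact (ae_restrict_iff' measurableSet_Ioo).2 (Eventually.of_forall fun r hr => hle r hr)
  exact hcmp.trans hdec

end Summit.NavierStokesRegularity.NavierStokesRegularity.Theorems.PoloidalLiouville.Indicatrix

end
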